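import Summits.ResolutionOfSingularities.ResolutionOfSingularities.Theorems.PurelyInseparableDim4ChartAtlasSNCJacobian
import HarnessLib

/-!
# Purely inseparable four-folds `z^p + F(x₁, …, x₄)`: the Jacobian engine for a centre presented by ANY finite set of generators
# (S3-N2 support — repair centres containing curved members; cell `res-dim4-pi`, typ-2 g6)

[OURS · counted 0] (D-0157 DOOR 2; DR-157-C; desk WORD #115 (a)/(c), #131 (c)). p701374's `hasSNCWith_𝓘Λ_of_jacobian` presents the centre
`V(y_Λ)` by its variables, so a boundary member CONTAINING the centre must itself be a variable. For the repair of FAR RESONANCE (p699206: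
after the translation `y_j ↦ y_j - c'` the resonant pair is `{y_j·𝒪, q·𝒪}`, `q = (yᵢ + b)·y_j - c'·yᵢ`, and the repair centre is
`Σ = V(y_0, y_T, y_j)`, with `q ∈ 𝓘_Σ`) the centre must be presented as `(y_0, y_{T ∖ i}, y_j, q)` — the same ideal, another generating set.
PROVED here (no `sorry`, no new axiom, every `n`, every field `K`):

* **`hasSNCWith_shf_of_jacobian`** — p701374's criterion VERBATIM for the centre `shf (span G)`, `G` any finite set of polynomials: at every
  prime `𝔭` the FAMILY is `Φ ∩ 𝔭` together with `G` when `G ⊆ 𝔭`; owners and ranks with unit diagonal and triangularity modulo `𝔭` give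
  `HasSNCWith E (shf (span G))`;
* `hasSNCWith_𝓘Λ_of_jacobian_of_span_eq` — the same for the coordinate centre `𝓘Λ n K Λ` presented by any `G` with `span G = (yᵢ : i ∈ Λ)`.

Nothing here is a statement about resolution of singularities in dimension ≥ 4 / characteristic `p` (NOT proved anywhere in this programme).
bears_on: LADDER-RESOLUTION:D157-DOOR2 (res-dim4-pi). Supports stmt-ResolutionOfSingularities-16155 (helper, S3-N2 engine).
-/

-- every declaration of this summit lives under `Summit.ResolutionOfSingularities.ResolutionOfSingularities`
-- (summit = problem), which the duplicate-namespace linter flags; house convention (cf. the Target file).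
set_option linter.dupNamespace false

noncomputable section

open MvPolynomial CategoryTheory AlgebraicGeometry Opposite TopologicalSpace IsLocalRing
open AlgebraicGeometry.Scheme.IdealSheafData (ofIdealTop)

namespace Summit.ResolutionOfSingularities.ResolutionOfSingularities.Theorems.PIDim4

open Literature.AlgebraicGeometry.Resolution
open Literature.AlgebraicGeometry.Resolution.AffinePointBlowup (P A γ coord Wtop ξ)
open Literature.AlgebraicGeometry.Hironaka2017.SpecOrders
open Literature.AlgebraicGeometry.Hironaka2017.Lib

namespace ChartDictionary

variable {n : ℕ} {K : Type} [Field K]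

/-- **SIMPLE NORMAL CROSSINGS WITH A CENTRE PRESENTED BY ANY FINITE GENERATING SET, FROM A POINTWISE TRIANGULAR JACOBIAN.** On `𝔸ⁿ⁺¹_K` let
`E` be a list of ideal sheaves each `⊤` or `q·𝒪` for some `q` in the finite set `Φ`, and let the centre be `V(G)`, `G` a finite set of
polynomials (`shf (span G)`). At a prime `𝔭` call FAMILY the `q ∈ Φ` with `q ∈ 𝔭` together with, if `G ⊆ 𝔭`, the members of `G`. If
owners `v 𝔭 q` and ranks `ρ 𝔭 q` can be assigned with `∂q/∂y_{v q} ∉ 𝔭` on the family and `∂q/∂y_{v q'} ∈ 𝔭` for distinct `q, q'` of the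
family with `ρ q ≤ ρ q'`, then `HasSNCWith E (shf (span G))`. -/
theorem hasSNCWith_shf_of_jacobian (E : List (P n K).IdealSheafData) (G : Finset (A n K)) (Φ : Finset (A n K))
    (hE : ∀ D ∈ E, D = ⊤ ∨ ∃ q ∈ Φ, D = ofIdealTop (Ideal.span {(γ n K).symm q}))
    (ρ : P n K → A n K → ℕ) (v : P n K → A n K → Fin (n + 1))
    (hdiag : ∀ (x : P n K) (q : A n K),
      (q ∈ Φ ∧ q ∈ x.asIdeal ∨ q ∈ G ∧ ∀ g ∈ G, g ∈ x.asIdeal) → pderiv (v x q) q ∉ x.asIdeal)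
    (htri : ∀ (x : P n K) (q q' : A n K),
      (q ∈ Φ ∧ q ∈ x.asIdeal ∨ q ∈ G ∧ ∀ g ∈ G, g ∈ x.asIdeal) →
      (q' ∈ Φ ∧ q' ∈ x.asIdeal ∨ q' ∈ G ∧ ∀ g ∈ G, g ∈ x.asIdeal) →
        q ≠ q' → ρ x q ≤ ρ x q' → pderiv (v x q') q ∈ x.asIdeal) :
    HasSNCWith E (shf (A n K) (Ideal.span (G : Set (A n K)))) := by
  classical
  refine hasSNCWith_of_isRsopPart_labels E _ fun x => ?_
  -- the family at `x`, as a finite set of polynomials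
  let fam : Finset (A n K) := Φ.filter (fun q => q ∈ x.asIdeal) ∪ (if ∀ g ∈ G, g ∈ x.asIdeal then G else ∅)
  have hfam : ∀ q, q ∈ fam ↔ (q ∈ Φ ∧ q ∈ x.asIdeal ∨ q ∈ G ∧ ∀ g ∈ G, g ∈ x.asIdeal) := by
    intro q
    rw [Finset.mem_union, Finset.mem_filter]
    refine or_congr Iff.rfl ?_
    by_cases hG : ∀ g ∈ G, g ∈ x.asIdeal
    · rw [if_pos hG]; exact ⟨fun h => ⟨h, hG⟩, fun h => h.1⟩
    · rw [if_neg hG]; exact ⟨fun h => absurd h (Finset.notMem_empty q), fun h => absurd h.2 hG⟩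
  have hfam𝔭 : ∀ q ∈ fam, q ∈ x.asIdeal := by
    intro q hq
    rcases (hfam q).mp hq with ⟨-, h⟩ | ⟨hq, h⟩
    · exact h
    · exact h q hq
  -- enumerate it
  set r := fam.card with hr
  let e : fam ≃ Fin r := fam.equivFin
  let f : Fin r → A n K := fun a => ((e.symm a : fam) : A n K)
  have hfmem : ∀ a, f a ∈ fam := fun a => (e.symm a).2
  have hfinj : Function.Injective f := Subtype.val_injective.comp e.symm.injective
  have hfe : ∀ q : fam, f (e q) = q := fun q => by
    simp only [f, Equiv.symm_apply_apply]
  -- the Jacobian minor and the part of a regular system of parameters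
  have hdet : (Matrix.of fun a b => pderiv (v x (f a)) (f b)).det ∉ x.asIdeal :=
    det_not_mem_of_rank x.asIdeal _ (fun a => ρ x (f a)) (fun a => hdiag x (f a) ((hfam _).mp (hfmem a)))
      (fun a b hab hρ => htri x (f b) (f a) ((hfam _).mp (hfmem b)) ((hfam _).mp (hfmem a))
        (fun e' => hab (hfinj e').symm) hρ)
  have hz : IsRsopPart fun a => algebraMap (A n K) ((P n K).presheaf.stalk x) (f a) :=
    isRsopPart_algebraMap_of_det_not_mem x f (fun a => hfam𝔭 _ (hfmem a)) (fun a => v x (f a)) hdet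
  -- the equation of a member of `E` through `x`
  have hEq : ∀ D : {D : (P n K).IdealSheafData // D ∈ E ∧ x ∈ D.support},
      ∃ q : fam, D.1 = ofIdealTop (Ideal.span {(γ n K).symm (q : A n K)}) := by
    intro D
    rcases hE D.1 D.2.1 with hD | ⟨q, hqΦ, hD⟩
    · exfalso
      have h := D.2.2
      rw [hD, Scheme.IdealSheafData.support_top] at h
      exact h
    · have hq𝔭 : q ∈ x.asIdeal := by
        have h := D.2.2
        rw [hD, mem_support_ofIdealTop_span_γ_symm_iff] at h
        exact h
      exact ⟨⟨q, (hfam q).mpr (Or.inl ⟨hqΦ, hq𝔭⟩)⟩, hD⟩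
  choose qf hqf using hEq
  refine ⟨r, _, hz, ⟨fun D => e (qf D), ?_, fun D => ?_⟩, fun hxC => ?_⟩
  · intro D₁ D₂ h12
    have h : qf D₁ = qf D₂ := e.injective h12
    apply Subtype.ext
    rw [hqf D₁, hqf D₂, h]
  · change stalkIdeal D.1 x = Ideal.span {algebraMap (A n K) ((P n K).presheaf.stalk x) (f (e (qf D)))}
    rw [hfe, hqf D, stalkIdeal_ofIdealTop_span_γ_symm]
  · -- the stalk of the centre is generated by the members of `G`, all in the family
    have hG : ∀ g ∈ G, g ∈ x.asIdeal := by
      have h := (mem_support_shf_iff (A n K) _ x).mp hxC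
      exact fun g hg => h (Ideal.subset_span (Finset.mem_coe.mpr hg))
    have hGmem : ∀ g ∈ G, g ∈ fam := fun g hg => (hfam _).mpr (Or.inr ⟨hg, hG⟩)
    refine ⟨{a | f a ∈ G}, ?_⟩
    rw [stalkIdeal_shf, Ideal.map_span]
    congr 1
    ext g
    constructor
    · rintro ⟨g₀, hg₀, rfl⟩
      refine ⟨e ⟨g₀, hGmem g₀ (Finset.mem_coe.mp hg₀)⟩, ?_, ?_⟩
      · change f (e ⟨g₀, _⟩) ∈ G
        rw [hfe]; exact Finset.mem_coe.mp hg₀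
      · change algebraMap (A n K) ((P n K).presheaf.stalk x) (f (e ⟨g₀, _⟩)) = _
        rw [hfe]
    · rintro ⟨a, ha, rfl⟩
      exact ⟨f a, Finset.mem_coe.mpr ha, rfl⟩

/-- **The coordinate centre presented by another generating set**: if `span G = (yᵢ : i ∈ Λ)` then the pointwise triangular Jacobian for the
family built from `G` gives `HasSNCWith E (𝓘Λ n K Λ)`. -/
theorem hasSNCWith_𝓘Λ_of_jacobian_of_span_eq (E : List (P n K).IdealSheafData) (Λ : Set (Fin (n + 1))) (G : Finset (A n K))
    (hG : Ideal.span (G : Set (A n K)) = Ideal.span (X '' Λ)) (Φ : Finset (A n K))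
    (hE : ∀ D ∈ E, D = ⊤ ∨ ∃ q ∈ Φ, D = ofIdealTop (Ideal.span {(γ n K).symm q}))
    (ρ : P n K → A n K → ℕ) (v : P n K → A n K → Fin (n + 1))
    (hdiag : ∀ (x : P n K) (q : A n K),
      (q ∈ Φ ∧ q ∈ x.asIdeal ∨ q ∈ G ∧ ∀ g ∈ G, g ∈ x.asIdeal) → pderiv (v x q) q ∉ x.asIdeal)
    (htri : ∀ (x : P n K) (q q' : A n K),
      (q ∈ Φ ∧ q ∈ x.asIdeal ∨ q ∈ G ∧ ∀ g ∈ G, g ∈ x.asIdeal) →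
      (q' ∈ Φ ∧ q' ∈ x.asIdeal ∨ q' ∈ G ∧ ∀ g ∈ G, g ∈ x.asIdeal) →
        q ≠ q' → ρ x q ≤ ρ x q' → pderiv (v x q') q ∈ x.asIdeal) :
    HasSNCWith E (AffineCoordBlowup.𝓘Λ n K Λ) := by
  rw [𝓘Λ_eq_shf, ← hG]
  exact hasSNCWith_shf_of_jacobian E G Φ hE ρ v hdiag htri

end ChartDictionary

end Summit.ResolutionOfSingularities.ResolutionOfSingularities.Theorems.PIDim4

end
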